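import Mathlib.LinearAlgebra.Matrix.Notation
import Mathlib.Tactic.LinearCombination
import Mathlib.Tactic.FinCases
import Mathlib.RingTheory.Ideal.Maps
import Summits.BirchSwinnertonDyer.Rank1Residual.X4.OldSupportedHeckeOperators
import HarnessLib

/-!
# Lemma L2 in the PAIR normalisation: Brandt-basis `𝒰 = !![0, −1; ℓ, T]` with the UNTWISTED Gram matrix `u = !![ℓ+1, T; T, ℓ+1]` (cell `b2b-bsdres`, seat additive-p4 gen 41, line V72/V64-D — K122)

HONEST FRAMING (verbatim, cell `b2b-bsdres`): the goal of the cell is to DELETE the COMBINATION-SHAPED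
residual classes for ALL analytic-rank `≤ 1` curves over `ℚ` — "full BSD formula for every rank `≤ 1`
curve in class `C`" assembled STRICTLY from published theorems — so that the rank-`≤ 1` remainder
becomes exactly the CONSTRUCTION-SHAPED classes, which are TYPED (missing-input Props), NOT attempted;
this is not "finishing BSD". This file: PURE MATRIX ALGEBRA over a commutative ring (0 defs, 0 facts,
nothing booked; X4 stays CONSTRUCTION-shaped).

## Why

`X4/LevelRaisingCongruenceIdeal.lean` (K104) proves Lemma L2 of memo V58 — `{s ∈ R[𝒰] : s ∈ M₂(R)·u} =
(𝒰² − 1)·R[𝒰]` — in two normalisations: (A) modular-curve differentials, `𝒰_A = !![T, ℓ; −1, 0]` with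
the untwisted Gram matrix `u_A = !![ℓ+1, T; T, ℓ+1]`, and (D) Brandt divisors, `𝒰_D = !![0, −1; ℓ, T]`
with the Atkin–Lehner-TWISTED Gram matrix `u_D = !![T, ℓ+1; ℓ+1, T]`. Proposition V64-D (memo V64 §4.3
(ii‴)) runs Lemma L1 for the PAIR `(S₀, Q₀)` of σ(θ)-forms on the definite algebra with their duality
pairing — no Atkin–Lehner twist — so the Gram matrix is `i₂† i₁ = u_A` while `U_{ℓ₁}` acts on the old
θ-forms in the Brandt basis by `𝒰_D`: the combination (𝒰_D, u_A), NOT covered by K104. This file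
supplies it:

* `eta_eq_mul_gram_pair` — `𝒰_D² − 1 = !![−1, 0; T, −1] · u_A` (so `η ∈ M₂(R)·u_A`);
* `levelRaisingIdeal_iff_pair` — `a·1 + b·𝒰_D ∈ M₂(R)·u_A ⟺ a·1 + b·𝒰_D ∈ (𝒰_D² − 1)·R[𝒰_D]`, any
  commutative `R`, no hypothesis;
* (Appendix, second landing) `keyIdentity_of_pairData` — (K^θ) in the hypothesis form of K107/K121 from
  the pair data (Gram `u_A`, `δ`-adjoint surjective, adjoint action = transpose, `ℓ₁`-old saturation, lift).
* `oldSupported_action_mem_etaIdeal_pair` — composed with K105's Lemma L1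
  (`oldSupported_action_mem_gramIdeal`, `u_A` symmetric): an old-supported operator (saturated sense)
  with surjective degeneracy adjoint and pair Gram matrix `u_A`, acting on the old plane through
  `a·1 + b·𝒰_D`, satisfies `a·1 + b·𝒰_D ∈ (𝒰_D² − 1)` — the key identity (K^θ) of Prop. V64-D in the form
  consumed by `keyIdentity_of_brandtData`-type assemblies.

No number theory enters; which Gram matrix the pair pairing produces is an input of the APPLICATION
(memo V64 §4.3), not decided here.

## References (context only)

* K. A. Ribet, Invent. Math. 100 (1990) 431–476, §3 (degeneracy maps, `η`). [cite: Ribet1990, §3]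
* F. Diamond, "The refined conjecture of Serre" (Hong Kong 1993 volume), §§3–4. [cite: Diamond1995RefinedSerre, §§3–4]
-/

namespace Summit.BirchSwinnertonDyer.Rank1Residual.LevelLowering

open Matrix

section PairNormalisation

variable {R : Type*} [CommRing R] {H' : Type*} [AddCommGroup H']

/-- `𝒰_D² − 1 = !![-1, 0; T, -1] * u_A`: in the pair normalisation `η = 𝒰² − 1` is a left
`M₂(R)`-multiple of the untwisted Gram matrix. [cite: Ribet1990, §3] -/
theorem eta_eq_mul_gram_pair (T ℓ : R) :
    !![(0 : R), -1; ℓ, T] * !![(0 : R), -1; ℓ, T] - (1 : Matrix (Fin 2) (Fin 2) R) =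
      !![(-1 : R), 0; T, -1] * !![ℓ + 1, T; T, ℓ + 1] := by
  ext i j
  fin_cases i <;> fin_cases j <;> simp [Matrix.mul_apply, Fin.sum_univ_two] <;> ring

/-- **Lemma L2, pair normalisation.** With `𝒰 = !![0, -1; ℓ, T]` and `u = !![ℓ+1, T; T, ℓ+1]`:
`a·1 + b·𝒰 ∈ M₂(R)·u` iff `a·1 + b·𝒰 ∈ (𝒰² − 1)·R[𝒰]`. No hypothesis on `R`, `T`, `ℓ`.
[cite: Ribet1990, §3] [cite: Diamond1995RefinedSerre, §§3–4] -/
theorem levelRaisingIdeal_iff_pair (T ℓ a b : R) :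
    (∃ m : Matrix (Fin 2) (Fin 2) R,
        a • (1 : Matrix (Fin 2) (Fin 2) R) + b • !![(0 : R), -1; ℓ, T] = m * !![ℓ + 1, T; T, ℓ + 1]) ↔
    (∃ c d : R, a • (1 : Matrix (Fin 2) (Fin 2) R) + b • !![(0 : R), -1; ℓ, T] =
        (c • (1 : Matrix (Fin 2) (Fin 2) R) + d • !![(0 : R), -1; ℓ, T]) *
          (!![(0 : R), -1; ℓ, T] * !![(0 : R), -1; ℓ, T] - 1)) := by
  constructor
  · rintro ⟨m, hm⟩
    -- the first row of `a·1 + b·𝒰 = m·u` reads `(a, -b) = (m 0 0, m 0 1)·u`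
    have h00 := congrFun (congrFun hm 0) 0
    have h01 := congrFun (congrFun hm 0) 1
    simp [Matrix.mul_apply, Fin.sum_univ_two] at h00 h01
    refine ⟨-(m 0 0 + T * m 0 1), m 0 1, ?_⟩
    ext i j
    fin_cases i <;> fin_cases j
    · simp [Matrix.mul_apply, Fin.sum_univ_two]
      linear_combination h00
    · simp [Matrix.mul_apply, Fin.sum_univ_two]
      linear_combination h01
    · simp [Matrix.mul_apply, Fin.sum_univ_two]
      linear_combination (-ℓ) * h01
    · simp [Matrix.mul_apply, Fin.sum_univ_two]
      linear_combination h00 - T * h01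
  · rintro ⟨c, d, hcd⟩
    refine ⟨(c • (1 : Matrix (Fin 2) (Fin 2) R) + d • !![(0 : R), -1; ℓ, T]) * !![(-1 : R), 0; T, -1], ?_⟩
    rw [hcd, eta_eq_mul_gram_pair, Matrix.mul_assoc]

/-- **Identity (K) in the pair normalisation** (K105 ∘ `levelRaisingIdeal_iff_pair`): an old-supported
operator (saturated sense) whose degeneracy adjoint is surjective with the untwisted PAIR Gram matrix
`u = !![ℓ+1, T; T, ℓ+1]`, acting on the old plane through `a·1 + b·𝒰_D` (the transpose of its adjoint
matrix), satisfies `a·1 + b·𝒰_D ∈ (𝒰_D² − 1)·R[𝒰_D]`. [cite: Ribet1990, §3]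
[cite: Diamond1995RefinedSerre, §§3–4] -/
theorem oldSupported_action_mem_etaIdeal_pair (T ℓ a b : R)
    (i : (Fin 2 → R) →+ H') (idag : H' →+ (Fin 2 → R)) (t : H' →+ H')
    (t₂' : Matrix (Fin 2) (Fin 2) R)
    (hu : ∀ v, idag (i v) = (!![ℓ + 1, T; T, ℓ + 1] : Matrix (Fin 2) (Fin 2) R).mulVec v)
    (hadj : ∀ h, idag (t h) = t₂'.mulVec (idag h))
    (hsat : ∀ h, ∃ v, t h = i v)
    (hsurj : Function.Surjective idag)
    (hact : t₂'.transpose = a • (1 : Matrix (Fin 2) (Fin 2) R) + b • !![(0 : R), -1; ℓ, T]) :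
    ∃ c d : R, a • (1 : Matrix (Fin 2) (Fin 2) R) + b • !![(0 : R), -1; ℓ, T] =
        (c • (1 : Matrix (Fin 2) (Fin 2) R) + d • !![(0 : R), -1; ℓ, T]) *
          (!![(0 : R), -1; ℓ, T] * !![(0 : R), -1; ℓ, T] - 1) := by
  have husymm : (!![ℓ + 1, T; T, ℓ + 1] : Matrix (Fin 2) (Fin 2) R).transpose =
      !![ℓ + 1, T; T, ℓ + 1] := by
    ext i j; fin_cases i <;> fin_cases j <;> rfl
  obtain ⟨m, hm⟩ := oldSupported_action_mem_gramIdeal i idag t _ t₂' husymm hu hadj hsat hsurj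
  exact (levelRaisingIdeal_iff_pair T ℓ a b).mp ⟨m, by rw [← hact, hm]⟩

end PairNormalisation

/-! ## Appendix (second landing, gen 41 — K122-2): the key identity (K^θ) of Prop. V64-D from the PAIR data

Word for word `keyIdentity_of_brandtData` of `X4/TwoPrimeSaturationOfMultiplicityOne.lean` (K121-2) with the
pair Gram matrix `u_A = !![ℓ+1, T; T, ℓ+1]` and `oldSupported_action_mem_etaIdeal_pair`: the local Hecke algebra
`T` (commutative) acts on `H′ = S₀(M₀′ℓ₁)_𝔪` by `act`, on the old plane `S₀(M₀′)² = Fin 2 → R` through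
`e₂ : T →+* M₂(R)` with `e₂(U_{ℓ₁}) = 𝒰_D`; `idag` = the adjoint of the degeneracy map of the PARTNER module
`Q₀` w.r.t. the duality pairing `S₀ × Q₀ → ℤ_p` (memo V64 §4.3 (ii‴)), surjective (Ihara for σ(θ)-forms,
adjoint form); `e₄` = the action on the `ℓ₁`-new θ-forms. The hypotheses `hpoly`/`hlift` are discharged /
reduced exactly as in K121-3 (`exists_eq_smul_one_add_smul_of_commute_companion`: the centralizer of `𝒰_D`
is `R·1 + R·𝒰_D`); the composition with K121's step (i) to 'T-V54 for S₀' is a five-line corollary once both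
files are importable together. NOTHING number-theoretic is proved here. -/

section PairKeyIdentity

variable {T R R₄ : Type*} [CommRing T] [CommRing R] [CommRing R₄] {H' : Type*} [AddCommGroup H']

/-- **(K^θ) from the pair data** (K122 + the lift): every `t` killing the `ℓ₁`-new θ-forms (`e₄ t = 0`)
satisfies `t − (U² − 1)·a ∈ ker e₂` for some `a ∈ T`. [cite: Ribet1990, §3]
[cite: Diamond1995RefinedSerre, §§3–4] -/
theorem keyIdentity_of_pairData (Tl ℓ : R) (e₂ : T →+* Matrix (Fin 2) (Fin 2) R) (e₄ : T →+* R₄)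
    (U : T) (hU : e₂ U = !![(0 : R), -1; ℓ, Tl])
    (act : T → (H' →+ H')) (i : (Fin 2 → R) →+ H') (idag : H' →+ (Fin 2 → R))
    (hu : ∀ v, idag (i v) = (!![ℓ + 1, Tl; Tl, ℓ + 1] : Matrix (Fin 2) (Fin 2) R).mulVec v)
    (hsurj : Function.Surjective idag)
    (hadj : ∀ t h, idag (act t h) = (e₂ t).transpose.mulVec (idag h))
    (hW' : ∀ t, e₄ t = 0 → ∀ h, ∃ v, act t h = i v)
    (hpoly : ∀ t, ∃ a b : R, e₂ t = a • (1 : Matrix (Fin 2) (Fin 2) R) + b • !![(0 : R), -1; ℓ, Tl])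
    (hlift : ∀ c d : R, ∃ a : T,
      e₂ a = c • (1 : Matrix (Fin 2) (Fin 2) R) + d • !![(0 : R), -1; ℓ, Tl]) :
    ∀ t ∈ RingHom.ker e₄, ∃ a : T, t - (U * U - 1) * a ∈ RingHom.ker e₂ := by
  intro t ht
  rw [RingHom.mem_ker] at ht
  obtain ⟨a, b, hab⟩ := hpoly t
  have hact : ((e₂ t).transpose).transpose =
      a • (1 : Matrix (Fin 2) (Fin 2) R) + b • !![(0 : R), -1; ℓ, Tl] := by
    rw [Matrix.transpose_transpose, hab]
  obtain ⟨c, d, hcd⟩ := oldSupported_action_mem_etaIdeal_pair Tl ℓ a b i idag (act t)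
    (e₂ t).transpose hu (hadj t) (hW' t ht) hsurj hact
  obtain ⟨a', ha'⟩ := hlift c d
  -- `c·1 + d·𝒰` commutes with `𝒰² − 1`
  have hcomm : (c • (1 : Matrix (Fin 2) (Fin 2) R) + d • !![(0 : R), -1; ℓ, Tl]) *
      (!![(0 : R), -1; ℓ, Tl] * !![(0 : R), -1; ℓ, Tl] - 1) =
      (!![(0 : R), -1; ℓ, Tl] * !![(0 : R), -1; ℓ, Tl] - 1) *
        (c • (1 : Matrix (Fin 2) (Fin 2) R) + d • !![(0 : R), -1; ℓ, Tl]) := by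
    have h𝒰 : Commute (!![(0 : R), -1; ℓ, Tl] : Matrix (Fin 2) (Fin 2) R)
        (!![(0 : R), -1; ℓ, Tl] * !![(0 : R), -1; ℓ, Tl] - 1) :=
      ((Commute.refl _).mul_right (Commute.refl _)).sub_right (Commute.one_right _)
    have h1 : Commute (c • (1 : Matrix (Fin 2) (Fin 2) R))
        (!![(0 : R), -1; ℓ, Tl] * !![(0 : R), -1; ℓ, Tl] - 1) :=
      (Commute.one_left _).smul_left c
    exact (h1.add_left (h𝒰.smul_left d)).eq
  refine ⟨a', ?_⟩
  rw [RingHom.mem_ker, map_sub, hab, hcd, map_mul, ha', map_sub, map_one, map_mul, hU, hcomm, sub_self]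

end PairKeyIdentity

end Summit.BirchSwinnertonDyer.Rank1Residual.LevelLowering
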